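import Mathlib
import HarnessLib
import Summits.HubbardSuperconductivity.HubbardSuperconductivity.Theorems.KLProgrammeKLRegimeEngineTowerWtStepLinkKlEng
import Summits.HubbardSuperconductivity.HubbardSuperconductivity.Theorems.KLProgrammeKLRegimeAlphaWtBlockFlowDeepVol
import Summits.HubbardSuperconductivity.HubbardSuperconductivity.Theorems.KLProgrammeKLRegimeTwoVolumeLipJumpRowsKlEng
import Summits.HubbardSuperconductivity.HubbardSuperconductivity.Theorems.KLProgrammeKLRegimeTwoVolumeLipGluedWt

/-!
# Route `KLProgramme` — crux K3 ENGINE (stmt-HubbardSuperconductivity-20437 `KLRegimeEngineV17F2`), stub (e) proof-input «(e)-D-ROWS»: THE TWO-VOLUME LINK's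
# PER-BLOCK FINE-VOLUME DATA FROM THE REGIME, DEEP WINDOW — the two-volume twin of E1's W2b `linkDataW_klEng`
# (seat hubbard-kl-k3c4-p1 g25, VL lane; `--supports` 20437; DROWS-SCOPE-g25 §13.8 rows N2/N3/N5 for `…TwoVolumeLipLawOfRowsBase1` at the fine volume `bL`, common
#  (coarse) flow frame `K_n = klFlowFrameU L M β U μ n`; suppliers `gram_sliceCT_bgmFat_sharp_klEng` at volume `bL` (N2, no window), `alphaWt_towerBlock_klEng_flow_deep_vol`
#  (N3, window) and `klJump_scaleWtRows_klEng_deep_vol` (N5, window); the glued weight is at most the fine weight `klGluedWt_le_klLabelWt_fine`)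

* `sum_mul_klGluedWt_pair_le` — a `klGluedWt`-weighted row of a matrix is at most its `klScaleWt (bL)`-weighted row (same rate);
* **`linkDataLip_klEng_deep`** — `∃ Cκ Cb CJ > 0`: under the regime binders (history at the COARSE volume `L`, frame `K_n`), for the fine volume `bL`
  (`L₃ ≤ bL`, `M₃(bL) ≤ M`), every block `k ≥ 1` with `2 ≤ dk`, `d(k+1) ≤ n_β+1`, `dk ≤ n`, the deep window `4^{n+2}·U ≤ 4^{2(dk−1)+dd}` and every rate `j ≥ dk`:
  Gram constant `κ_k > 0` with `κ_k²8^{dk} ≤ κ̄²` and `IsGramBoundedR`; glued-weight rows/cols of the fine block covariance `≤ α_k := Cb(M/β)/Λ_{d(k+1)} ≤ ᾱ·4^{dk}`;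
  one-step transfer rows/cols of `klLipTransfer (bL) = klJump (bL) (dk) (dk−1)` `≤ 2·CJ` — the hypotheses `hκ hκκb hGB hrow hcol hααb hrowT hcolT` of
  `…TwoVolumeLipStepLinkUniform.klLipBornDiffSup_le_kitStep_of_bounds` / `…LawOfRowsBase1` at that block.

Compositions of landed theorems; nothing about the model is asserted beyond them; nothing asserts the (D) rows, stub (e), VL, K3 or superconductivity.
References: BGM 2006 §2.7 (2.71a), §2.8 (2.77), (2.81)–(2.83) [cite: BenfattoGiulianiMastropietro2006].
-/

noncomputable section

namespace Summit.HubbardSuperconductivity.HubbardSuperconductivity.Theorems.TwoVolumeLip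

set_option linter.dupNamespace false -- summit = problem name (single-conjunct summit), D-0017

open Classical
open Real Finset Literature.MathematicalPhysics.QuantumLattice Literature.Probability.LatticeModels GrassmannAlgebra
open Literature.MathematicalPhysics.QuantumLattice.FermiRG
open Summit.HubbardSuperconductivity.HubbardSuperconductivity.Theorems.KLProgrammeLegKernels
open Summit.HubbardSuperconductivity.HubbardSuperconductivity.Theorems.KLRegimeSplit
open Summit.HubbardSuperconductivity.HubbardSuperconductivity.Theorems.DispersionFlow
open Summit.HubbardSuperconductivity.HubbardSuperconductivity.Theorems.EngineV8
open Summit.HubbardSuperconductivity.HubbardSuperconductivity.Theorems.TorusFourierL2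

/-- **A `klGluedWt`-weighted row is at most the `klScaleWt (bL)`-weighted row** (same rate `J`; `klGluedWt_le_klLabelWt_fine`, `klLabelWt_apply`). -/
theorem sum_mul_klGluedWt_pair_le {L b M N : ℕ} [NeZero L] [NeZero (b * L)] (β : ℝ) (J : ℕ) {ι : Type*} (s : Finset ι)
    (f : ι → ℝ) (hf : ∀ i, 0 ≤ f i) (X Y : ι → SpaceTimeIdx (b * L) M × SectorLeg N) :
    ∑ i ∈ s, f i * klGluedWt L b M β J N {X i, Y i} ≤
      ∑ i ∈ s, f i * klScaleWt (b * L) M β J {latticeLegPos (2 * (2 * M)) (X i), latticeLegPos (2 * (2 * M)) (Y i)} := by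
  refine sum_le_sum fun i _ => mul_le_mul_of_nonneg_left ?_ (hf i)
  refine (klGluedWt_le_klLabelWt_fine β J _).trans (le_of_eq ?_)
  rw [klLabelWt_apply, Finset.image_insert, Finset.image_singleton]

set_option maxHeartbeats 1600000 in -- long binder list
/-- **THE TWO-VOLUME LINK's PER-BLOCK FINE-VOLUME DATA FROM THE REGIME, DEEP WINDOW** (see the module docstring).
[cite: BenfattoGiulianiMastropietro2006, §2.7 (2.71a), §2.8 (2.77), (2.81)-(2.83)] -/
theorem linkDataLip_klEng_deep (d dd : ℕ) :
    ∃ Cκ Cb CJ : ℝ, 0 < Cκ ∧ 0 < Cb ∧ 0 < CJ ∧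
      ∀ (G : GeoConsts) (P : SplitConsts) (R : RenConsts) (Q : EngConsts) (c : ℝ), P.WF → R.WF2 → 0 < c → c ≤ klEngC₃6 P R →
      ∀ μ ∈ klWindowC, ∀ U : ℝ, 0 < U → U ≤ klEngU₀9 P R c →
      ∀ β : ℝ, klBetaMin ≤ β → β ≤ Real.exp (c / U ^ 2) →
      ∀ (L M : ℕ) [NeZero L] [NeZero M], klEngL₃ β U ≤ L → klEngM₃ β U L ≤ M →
      ∀ n : ℕ, 1 ≤ n → n ≤ nScales β + 1 →
        HistP klPredsV17F2 L M G P Q R β U μ 0 n → FrameOK R U (nScales β) μ (klFlowFrameU L M β U μ n) →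
      ∀ (b : ℕ) [NeZero (b * L)], klEngL₃ β U ≤ b * L → klEngM₃ β U (b * L) ≤ M →
      ∀ k : ℕ, 1 ≤ k → 2 ≤ d * k → d * (k + 1) ≤ nScales β + 1 → d * k ≤ n → (4 : ℝ) ^ (n + 2) * U ≤ (4 : ℝ) ^ (2 * (d * k - 1) + dd) →
      ∀ j : ℕ, d * k ≤ j →
        0 < Real.sqrt (Cκ * (klScale klE0 (d * k) / klScale klE0 (d * k - 1)) * (klE0 * ((8 : ℝ) ^ (d * k - 1))⁻¹)) ∧
        Real.sqrt (Cκ * (klScale klE0 (d * k) / klScale klE0 (d * k - 1)) * (klE0 * ((8 : ℝ) ^ (d * k - 1))⁻¹)) ^ 2 * (8 : ℝ) ^ (d * k) ≤ Real.sqrt (2 * Cκ * klE0) ^ 2 ∧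
        IsGramBoundedR ((sectorSubMatrix (b * L) M β (bgmFatMultiplier (b * L) M klE0 β (nambuXiCT (b * L) μ (klFlowFrameU L M β U μ n)) (d * k - 1))).transpose * hubbardCovSliceCT (b * L) M β μ 0 (klFlowFrameU L M β U μ n) (klScale klE0 (d * (k + 1))) (klScale klE0 (d * k)) * sectorSubMatrix (b * L) M β (bgmFatMultiplier (b * L) M klE0 β (nambuXiCT (b * L) μ (klFlowFrameU L M β U μ n)) (d * k - 1))) (Real.sqrt (Cκ * (klScale klE0 (d * k) / klScale klE0 (d * k - 1)) * (klE0 * ((8 : ℝ) ^ (d * k - 1))⁻¹))) ∧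
        (∀ X, ∑ Y, ‖((sectorSubMatrix (b * L) M β (bgmFatMultiplier (b * L) M klE0 β (nambuXiCT (b * L) μ (klFlowFrameU L M β U μ n)) (d * k - 1))).transpose * hubbardCovSliceCT (b * L) M β μ 0 (klFlowFrameU L M β U μ n) (klScale klE0 (d * (k + 1))) (klScale klE0 (d * k)) * sectorSubMatrix (b * L) M β (bgmFatMultiplier (b * L) M klE0 β (nambuXiCT (b * L) μ (klFlowFrameU L M β U μ n)) (d * k - 1))) X Y‖ * klGluedWt L b M β j (sectorCount (d * k - 1)) {X, Y} ≤ Cb * ((M : ℝ) / β) / klScale klE0 (d * (k + 1))) ∧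
        (∀ Y, ∑ X, ‖((sectorSubMatrix (b * L) M β (bgmFatMultiplier (b * L) M klE0 β (nambuXiCT (b * L) μ (klFlowFrameU L M β U μ n)) (d * k - 1))).transpose * hubbardCovSliceCT (b * L) M β μ 0 (klFlowFrameU L M β U μ n) (klScale klE0 (d * (k + 1))) (klScale klE0 (d * k)) * sectorSubMatrix (b * L) M β (bgmFatMultiplier (b * L) M klE0 β (nambuXiCT (b * L) μ (klFlowFrameU L M β U μ n)) (d * k - 1))) X Y‖ * klGluedWt L b M β j (sectorCount (d * k - 1)) {X, Y} ≤ Cb * ((M : ℝ) / β) / klScale klE0 (d * (k + 1))) ∧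
        Cb * ((M : ℝ) / β) / klScale klE0 (d * (k + 1)) ≤ Cb * ((M : ℝ) / β) * (4 : ℝ) ^ d / klE0 * (4 : ℝ) ^ (d * k) ∧
        (∀ x, ∑ y', ‖klLipTransfer (b * L) M β μ (klFlowFrameU L M β U μ n) d k x y'‖ *
          klScaleWt (b * L) M β j {latticeLegPos (2 * (2 * M)) x, latticeLegPos (2 * (2 * M)) y'} ≤ 2 * CJ) ∧
        (∀ y', ∑ x, ‖klLipTransfer (b * L) M β μ (klFlowFrameU L M β U μ n) d k x y'‖ *
          klScaleWt (b * L) M β j {latticeLegPos (2 * (2 * M)) x, latticeLegPos (2 * (2 * M)) y'} ≤ 2 * CJ) := by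
  obtain ⟨Cκ, hCκ, hg⟩ := gram_sliceCT_bgmFat_sharp_klEng
  obtain ⟨Cb, hCb, hαp⟩ := alphaWt_towerBlock_klEng_flow_deep_vol d dd
  obtain ⟨CJ, hCJ, hop⟩ := klJump_scaleWtRows_klEng_deep_vol dd
  refine ⟨Cκ, Cb, CJ, hCκ, hCb, hCJ, ?_⟩
  intro G P R Q c hP hR2 hc hc6 μ hμ U hU hU9 β hβmin hβc L M _ _ hL3 hM3 n hn1 hnN hhist hfr b _ hbL3 hbM3 k hk1 hdk hkN hkn hwin j hkj
  have he : (0 : ℝ) < klE0 := by norm_num [klE0]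
  have hβ : 0 < β := KLRegimeSplit.pos_of_klBetaMin_le hβmin
  have hM0 : (0 : ℝ) < M := Nat.cast_pos.2 (Nat.pos_of_ne_zero (NeZero.ne M))
  have hU4 : U ≤ klEngU₀4 P R c := hU9.trans (klEngU₀9_le_klEngU₀4 P R c)
  have hU3g : U ≤ min (klEngU₀3 P R c) (1 / (R.Gfr 3 + 1)) :=
    le_min (hU9.trans (klEngU₀9_le_klEngU₀3 P R c)) (hU9.trans (klEngU₀9_le_inv_gfr_add_one P hR2.wf c (by norm_num)))
  have hc3 : c ≤ klEngC₃3 P R := hc6.trans (klEngC₃6_le_klEngC₃3 P R)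
  set K : TrigPolyC4v := klFlowFrameU L M β U μ n with hKdef
  obtain ⟨hrow, hcol⟩ := hαp G P R Q c hR2 hc hc6 μ hμ U hU hU3g β hβmin hβc L M hL3 hM3 n hn1 hnN hhist hfr (b * L) hbL3 k hk1 hdk hkN hwin j hkj
  have hwin' : (4 : ℝ) ^ n * U ≤ (4 : ℝ) ^ (2 * (d * k - 1 + 1) + dd) := by
    have h16 : (4 : ℝ) ^ n * U ≤ (4 : ℝ) ^ (n + 2) * U := by
      have : (4 : ℝ) ^ n ≤ (4 : ℝ) ^ (n + 2) := pow_le_pow_right₀ (by norm_num) (by omega)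
      exact mul_le_mul_of_nonneg_right this hU.le
    exact (h16.trans hwin).trans (pow_le_pow_right₀ (by norm_num) (by omega))
  obtain ⟨hrowT, hcolT⟩ := hop G P R Q c hR2 hc hc6 μ hμ U hU hU3g β hβmin hβc L M hL3 hM3 n hn1 hnN hhist hfr (b * L) hbL3 (d * k - 1) (d * k)
    (by omega) hkn hwin' j hkj
  have h2 : (2 : ℝ) ^ (d * k - (d * k - 1)) = 2 := by rw [show d * k - (d * k - 1) = 1 by omega, pow_one]
  refine ⟨?_, ?_, ?_, ?_, ?_, ?_, ?_, ?_⟩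
  · have h1 : 0 < klScale klE0 (d * k) := klth_klScale_pos _
    have h2' : 0 < klScale klE0 (d * k - 1) := klth_klScale_pos _
    exact Real.sqrt_pos.2 (by positivity)
  · rw [gramF_sq_mul_pow_eq hCκ.le (by omega)]
  · have hΛpos : 0 < klScale klE0 (d * (k + 1)) := klth_klScale_pos _
    have hΛle : klScale klE0 (d * (k + 1)) ≤ klScale klE0 (d * k) := klScale_le_klScale he.le (Nat.mul_le_mul_left d (Nat.le_succ k))
    have hΛle' : klScale klE0 (d * k) ≤ klScale klE0 (d * k - 1) := klScale_le_klScale he.le (by omega)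
    obtain ⟨m, hm⟩ : ∃ m, d * k - 1 = m + 1 := ⟨d * k - 2, by omega⟩
    have h := (hg P R c hP hR2 hc hc3 μ hμ U hU hU4 β hβmin hβc K hfr (b * L) M hbL3 hbM3 m (by omega)
      (klScale klE0 (d * (k + 1))) (klScale klE0 (d * k)) hΛpos hΛle (by rw [← hm]; exact hΛle')).2.1
    rw [← hm] at h
    exact h
  · intro X
    exact (sum_mul_klGluedWt_pair_le β j _ _ (fun Y => norm_nonneg _) (fun _ => X) (fun Y => Y)).trans (hrow X)
  · intro Y
    exact (sum_mul_klGluedWt_pair_le β j _ _ (fun X => norm_nonneg _) (fun X => X) (fun _ => Y)).trans (hcol Y)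
  · rw [alphaF_eq_bound_mul_pow]
  · intro x
    have h := hrowT x
    rw [h2] at h
    rw [klLipTransfer_eq_klJump]
    linarith [h]
  · intro y'
    have h := hcolT y'
    rw [h2] at h
    rw [klLipTransfer_eq_klJump]
    linarith [h]

end Summit.HubbardSuperconductivity.HubbardSuperconductivity.Theorems.TwoVolumeLip

end
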